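import Summits.QuantumFields.YangMills.Theorems.UnitScaleTiltProp7QkAdjointSupRowOfRegPr
import Summits.QuantumFields.YangMills.Theorems.UnitScaleTiltProp7QkCutoffCommutator
import Summits.QuantumFields.YangMills.Theorems.UnitScaleTiltProp7BlockDistanceWeights
import HarnessLib

/-!
# Route `UnitScaleTilt`, crux K1 «MinimiserStabilityRegPr» (stmt-QuantumFields-19200), EX face S46 — (L3′b), ONE-FORM STOREY — **THE DECAYED KERNEL ROW `hk_Q` OF THE AVERAGING
# PENALTY `a·Q_k(U₀)†Q_k(U₀)` IN THE TEXT OF O4e ✓∕⧗`Prop7OneFormRemainderDecay.norm_symm_apply_le_of_kernelRow_blockDecay`'s `hk`, MODULO the entrywise letter (COL)**: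
# `‖toL2⁻¹(Q_k†(a•Q_k(toL2(δ_b ⊗ Z))))(bd)‖ ≤ (2·a·C_Q²·(cB∕c₀)·ℓ⁻⁶·e^{μ′})·e^{−μ′·tdist(B b₋, B bd₋)}·‖Z‖` at a printed-regular background, every `μ′ ≥ 0` (★p1 g26 08:10:02Z
# «`hk_Q` (tube-local, open)» + №13 «mind the normalisation: O4e needs `Ck_Q ∝ ℓ⁻³`»; width seat `ym3-torus-px21` gen 14)

Cell `ym3-torus` (HUMAN RULING D-0037; rung R3 = SU(2) YM₃ on T³ — NOT d = 4, NOT infinite volume, NOT a mass gap, NOT Clay).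
THEOREMS ONLY (0 `def`, 0 `sorry`, default heartbeats); `--supports stmt-QuantumFields-19200 --as helper`; count-neutral.

THE TWO HALVES.  DECAY = TUBE LOCALITY, a theorem: `QTwS U₀ (δ_b⊗Z) ĉ = 0` unless `B(b₋) ∈ {ĉ₋, ĉ₊}` (✓`Prop7CmapTwSReadSet.QTwS_apply_eq_zero_of_vanish_on_reads`), and by px17's
duality ✓`inner_toL2_single_adjoint_Qk` the `bd`-entry of `Q_k†W` reads only the `ĉ` with `B(bd₋) ∈ {ĉ₋, ĉ₊}`; so the kernel VANISHES unless `tdist(B b₋, B bd₋) ≤ 1` (✓`tdist_src_tgt_le_one`),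
and `1 ≤ e^{μ′}e^{−μ′·t}` there (§1).  SIZE = the open letter (COL): O4e multiplies `Ck` by `√(d·ℓ^d∕c₀) = √d·ℓ³` at the pin `c₀ = ℓ⁻³`, so the row must carry `Ck_Q ∝ ℓ⁻³` there
(★p1 g26 №13) — the `L²` shortcut (`‖Q_k†Q_k‖ ≤ N_Q²`, entry `≤ √2·a·N_Q²·‖Z‖ = O(1)`) loses exactly the `ℓ³` of the tube support and is NOT used; instead the entry is px17's SUP ROW of
`Q_k†` ✓`norm_toL2_symm_adjoint_Qk_apply_le_of_col` (from (COL)) at `Y := toL2B⁻¹(a•Q_k(toL2(δ_b⊗Z)))`, whose sup is one term of (COL): `a·η·C_Q·ℓ⁻²‖Z‖ = a·C_Q·ℓ⁻³‖Z‖` (§2).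
WHAT IS PROVED (ns `Summit.QuantumFields.YangMills.Theorems.Prop7QkPenaltyKernelRow`; member `F`, `n ≤ K`, weights `c₀ cB`).
* §1 ★ `QTwS_single_eq_zero_of_not_read` (tube locality of the averaging of record on a one-bond spike), ★★ `symm_adjointQk_smul_Qk_single_eq_zero_of_far` (the kernel of `Q_k†(a•Q_k)`
  VANISHES at `tdist(B b₋, B bd₋) > 1`; `RegPr`, `10¹²L³ε₀ ≤ 1`).
* §2 ★★★ `hkQ_of_col` — `RegPr F n K ε₀ U₀`, `10¹²L³ε₀ ≤ 1`, `0 ≤ a`, `0 ≤ μ′`, (COL) with constant `C_Q` (px17's binder VERBATIM): FOR EVERY `b Z bd`,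
  `‖(toL2 F K c₀).symm (Qk†(((a:ℝ):ℂ) • Qk (toL2 (Pi.single b Z)))) bd‖ ≤ (2·a·C_Q²·(cB∕c₀)·ℓ⁻⁶·e^{μ′})·exp(−(μ′·tdist(B b.src, B bd.src)))·‖Z‖` — O4e's `hk` TEXT for `B := Q_k†∘(a•Q_k)`;
  at the pins `a = a₀(c₀∕cB)ℓ³`: `Ck_Q = 2a₀C_Q²e^{μ′}·ℓ⁻³` — the normalisation O4e needs; K-FREE iff (COL) is.
HYP-SAT (★★OWNER RULING №42): `RegPr` + the window as ✓`QTwS_apply_eq_zero_of_vanish_on_reads` (inhabited on the literal families); (COL) = the booked OPEN letter of the one-form book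
(★p1 g26 CHAIR WORD №5 (b); flat `C_Q = 1` by px21 g5 ✓`Prop7QkAdjointFlatKernel`), displayed honestly, not a restatement of the conclusion; nothing eventual.
HONEST SCOPE.  A kernel letter modulo (COL); nothing of O4e's knit, (COL), the ten EX rows, `hT`, EX or the crux is proved here; the Yang–Mills mass gap is NOT proved.

References: T. Bałaban, CMP **99** (1985) 389–434 [Balaban1985BackgroundPropagators] ((3.13)–(3.16) p.393, Thm 3.1 (3.42) p.397, (3.49) p.399); CMP **95** (1984) 17–40
[Balaban1984PropagatorsI] ((1.18) p.20).
-/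

set_option autoImplicit false

noncomputable section

open scoped BigOperators Matrix.Norms.L2Operator InnerProductSpace ComplexConjugate

namespace Summit.QuantumFields.YangMills.Theorems.Prop7QkPenaltyKernelRow

open Literature.MathematicalPhysics.QuantumFieldTheory.Balaban1983to89
open Literature.MathematicalPhysics.QuantumFieldTheory.Balaban1983to89.T3ContinuumYM3Torus
open T3SectALandauChart (eta eta_pos)
open T3PrintedRegularMinimiser (RegPr)
open T3PrintedRegularOrbits (sites_eq)
open T3LevelShift (bondShift)
open B9Eq311L2Pairing (WL2)
open B11Eq103H1Complex (BondL2K)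
open B5Eq118OneStroke (iterBlockOf)
open Summit.QuantumFields.YangMills.Theorems.Prop7SectET3Transport (periodsT3 bondEquiv)
open Summit.QuantumFields.YangMills.Theorems.Prop7SectET3HilbertLetters (W₂ frobEquiv toL2 toL2B inner_toL2 inner_toL2B toL2_apply toL2_symm_apply inner_frobEquiv_symm)
open Summit.QuantumFields.YangMills.Theorems.Prop7SectET3CurvedPropagators (Qk)
open Summit.QuantumFields.YangMills.Theorems.Prop7SymAvgTwSym (QTwS)
open Summit.QuantumFields.YangMills.Theorems.Prop7TransverseRowOfTubeRowRegPr (Qk_toL2)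
open Summit.QuantumFields.YangMills.Theorems.Prop7RieszTauFrobNorm (norm_le_norm_frobEquiv_symm norm_frobEquiv_symm_le norm_frobEquiv_le)
open Summit.QuantumFields.YangMills.Theorems.Prop7CmapTwSReadSet (QTwS_apply_eq_zero_of_vanish_on_reads)
open Summit.QuantumFields.YangMills.Theorems.Prop7QkAdjointSupRowOfRegPr (inner_toL2_single_adjoint_Qk inner_toL2_single_self norm_toL2_symm_adjoint_Qk_apply_le_of_col)
open Summit.QuantumFields.YangMills.Theorems.Prop7BlockDistanceWeights (tdist_src_tgt_le_one tdist_coarse_comm)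

variable (F : T3Family) {n K : ℕ} (h : n ≤ K) (c₀ cB : ℝ) [Fact (0 < c₀)] [Fact (0 < cB)]

/-! ## §1 Tube locality of the kernel of `Q_k†Q_k` -/

/-- ★ **THE AVERAGING OF RECORD DOES NOT SEE A SPIKE OUTSIDE ITS READ SET**: if the source block of `b` is neither `ĉ₋` nor `ĉ₊`, then `QTwS U₀ (δ_b ⊗ Z) ĉ = 0`
(✓`QTwS_apply_eq_zero_of_vanish_on_reads`). [cite: Balaban1985BackgroundPropagators, (3.13)–(3.14) p.393; Balaban1985Averaging, (110) p.34] -/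
theorem QTwS_single_eq_zero_of_not_read {ε₀ : ℝ} (hε₀ : 0 < ε₀) (hε12 : 10 ^ 12 * (F.L : ℝ) ^ 3 * ε₀ ≤ 1)
    (U₀ : GaugeField (F.P K) 0 (Matrix.specialUnitaryGroup (Fin 2) ℂ)) (hreg : RegPr F n K ε₀ U₀)
    (b : PBond (F.P K) 0) (Z : Matrix (Fin 2) (Fin 2) ℂ) (c : PBond (F.P n) 0)
    (hb : ¬ (iterBlockOf (K - n) b.src = (bondShift (sites_eq F n K h) c).src ∨ iterBlockOf (K - n) b.src = (bondShift (sites_eq F n K h) c).tgt)) :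
    QTwS F n K h U₀ (Pi.single b Z) c = 0 := by
  classical
  have hL3 : (3 : ℝ) ≤ F.L := by
    have h3 : 3 ≤ F.L := by obtain ⟨a, ha⟩ := F.hL.1; have := F.hL.2; omega
    exact_mod_cast h3
  set e : ℝ := (10 ^ 9 * (F.L : ℝ) ^ 2)⁻¹ with he_def
  have he : 0 < e := by rw [he_def]; positivity
  have hWe : 10 ^ 9 * (F.L : ℝ) ^ 2 * e ≤ 1 := by rw [he_def, mul_inv_cancel₀ (by positivity)]
  refine QTwS_apply_eq_zero_of_vanish_on_reads F n K h hε₀ he hWe hε12 U₀ hreg (Pi.single b Z) c fun b' hbs _ => ?_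
  by_cases hbb : b' = b
  · subst hbb; exact absurd hbs hb
  · rw [Pi.single_eq_of_ne hbb]

/-- ★★ **THE KERNEL OF `Q_k†(a•Q_k)` VANISHES BEYOND ADJACENT BLOCKS**: if `tdist(B b₋, B bd₋) > 1` then `toL2⁻¹(Q_k(U₀)†(a • Q_k(U₀)(toL2(δ_b ⊗ Z))))(bd) = 0` — the `bd`-entry
pairs (px17's duality ✓`inner_toL2_single_adjoint_Qk`) the spreads `QTwS(δ_bd ⊗ ·)(ĉ)` and `QTwS(δ_b ⊗ Z)(ĉ)`, which are never both non-zero (`B b₋, B bd₋ ∈ {ĉ₋, ĉ₊}` would give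
`tdist ≤ 1`, ✓`tdist_src_tgt_le_one`). [cite: Balaban1985BackgroundPropagators, (3.13)–(3.16) p.393; Balaban1984PropagatorsI, (1.18) p.20] -/
theorem symm_adjointQk_smul_Qk_single_eq_zero_of_far {ε₀ : ℝ} (hε₀ : 0 < ε₀) (hε12 : 10 ^ 12 * (F.L : ℝ) ^ 3 * ε₀ ≤ 1)
    (U₀ : GaugeField (F.P K) 0 (Matrix.specialUnitaryGroup (Fin 2) ℂ)) (hreg : RegPr F n K ε₀ U₀) (a : ℂ)
    (b : PBond (F.P K) 0) (Z : Matrix (Fin 2) (Fin 2) ℂ) (bd : PBond (F.P K) 0)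
    (hfar : 1 < Site.tdist (P := F.P K) (iterBlockOf (K - n) b.src) (iterBlockOf (K - n) bd.src)) :
    (toL2 F K c₀).symm (LinearMap.adjoint (Qk F n K h c₀ cB U₀) (a • Qk F n K h c₀ cB U₀ (toL2 F K c₀ (Pi.single b Z)))) bd = 0 := by
  classical
  have hc₀ : 0 < c₀ := Fact.out
  -- the vector `u` and its readback `E`
  set u := LinearMap.adjoint (Qk F n K h c₀ cB U₀) (a • Qk F n K h c₀ cB U₀ (toL2 F K c₀ (Pi.single b Z))) with hu
  set Ef : PBond (F.P K) 0 → Matrix (Fin 2) (Fin 2) ℂ := (toL2 F K c₀).symm u with hEf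
  have huE : u = toL2 F K c₀ Ef := by rw [hEf, LinearEquiv.apply_symm_apply]
  -- `a • Q_k(toL2(δ_b ⊗ Z)) = toL2B Y`
  set Y : PBond (F.P n) 0 → Matrix (Fin 2) (Fin 2) ℂ := fun c => (a * ((eta F n K : ℝ) : ℂ)) • QTwS F n K h U₀ (Pi.single b Z) c with hY
  have hQY : a • Qk F n K h c₀ cB U₀ (toL2 F K c₀ (Pi.single b Z)) = toL2B F n cB Y := by
    rw [Qk_toL2, smul_smul, ← map_smul]; rfl
  -- the pairing of the spike at `bd` with `u` vanishes
  have hpair : ⟪toL2 F K c₀ (Pi.single bd (Ef bd)), u⟫_ℂ = 0 := by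
    rw [hu, hQY, inner_toL2_single_adjoint_Qk F h c₀ cB U₀ Y bd (Ef bd)]
    have hsum : ∑ c : PBond (F.P n) 0, Matrix.trace ((QTwS F n K h U₀ (Pi.single bd (Ef bd)) c).conjTranspose * Y c) = 0 := by
      refine Finset.sum_eq_zero fun c _ => ?_
      by_cases hbd : (iterBlockOf (K - n) bd.src = (bondShift (sites_eq F n K h) c).src ∨ iterBlockOf (K - n) bd.src = (bondShift (sites_eq F n K h) c).tgt)
      · -- then `b` is NOT read by `c`, else the two blocks would be `≤ 1` apart
        have hb : ¬ (iterBlockOf (K - n) b.src = (bondShift (sites_eq F n K h) c).src ∨ iterBlockOf (K - n) b.src = (bondShift (sites_eq F n K h) c).tgt) := by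
          intro hb
          have h1 := tdist_src_tgt_le_one (bondShift (sites_eq F n K h) c)
          have hle : Site.tdist (P := F.P K) (iterBlockOf (K - n) b.src) (iterBlockOf (K - n) bd.src) ≤ 1 := by
            rcases hb with hb | hb <;> rcases hbd with hbd | hbd <;> rw [hb, hbd]
            · simp [Site.tdist]
            · exact h1
            · rw [B3Taylor310LocalRemainder.tdist_comm]; exact h1
            · simp [Site.tdist]
          omega
        rw [hY]
        simp only
        rw [QTwS_single_eq_zero_of_not_read F h hε₀ hε12 U₀ hreg b Z c hb, smul_zero, Matrix.mul_zero, Matrix.trace_zero]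
      · rw [QTwS_single_eq_zero_of_not_read F h hε₀ hε12 U₀ hreg bd (Ef bd) c hbd, Matrix.conjTranspose_zero, Matrix.zero_mul, Matrix.trace_zero]
    rw [hsum, mul_zero]
  -- hence `Ef bd = 0`
  have hself := inner_toL2_single_self F c₀ Ef bd
  rw [← huE, hpair] at hself
  have hn : c₀ * ‖(frobEquiv.symm (Ef bd) : W₂)‖ ^ 2 = 0 := by exact_mod_cast hself.symm
  have hz : ‖(frobEquiv.symm (Ef bd) : W₂)‖ = 0 := by
    have := (mul_eq_zero.mp hn).resolve_left hc₀.ne'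
    exact pow_eq_zero_iff (n := 2) (by norm_num) |>.mp this
  have hE0 : (frobEquiv.symm (Ef bd) : W₂) = 0 := norm_eq_zero.mp hz
  have : Ef bd = 0 := by
    have := congrArg frobEquiv hE0
    rw [LinearEquiv.apply_symm_apply, map_zero] at this
    exact this
  rw [hEf] at this
  exact this

/-! ## §2 ★★★ The kernel row `hk_Q` modulo (COL) -/

/-- ★★★ **THE DECAYED KERNEL ROW OF THE AVERAGING PENALTY, IN O4e's `hk` TEXT, MODULO (COL).**  `RegPr F n K ε₀ U₀` (`10¹²L³ε₀ ≤ 1`), `0 ≤ a`, `0 ≤ μ′`, and px17's displayed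
column letter (COL) `hcol : Σ_c ‖QTwS U₀ (δ_b⊗X) c‖ ≤ C_Q·ℓ⁻²·‖X‖` (✓`Prop7QkAdjointSupRowOfRegPr.norm_toL2_symm_adjoint_Qk_apply_le_of_col`'s binder VERBATIM; flat: `C_Q = 1`): for every `b Z bd`,
`‖toL2⁻¹(Q_k(U₀)†(a • Q_k(U₀)(toL2(δ_b ⊗ Z))))(bd)‖ ≤ (2·a·C_Q²·(cB∕c₀)·ℓ⁻⁶·e^{μ′})·e^{−μ′·tdist(B b₋, B bd₋)}·‖Z‖` — the entry is px17's SUP ROW of `Q_k†` at `Y := toL2B⁻¹(a•Q_k(toL2(δ_b⊗Z)))`, whose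
sup is `≤ a·η·C_Q·ℓ⁻²·‖Z‖ = a·C_Q·ℓ⁻³‖Z‖` (one term of (COL), `η = ℓ⁻¹`); the decay is §1 (`1 ≤ e^{μ′}e^{−μ′t}` on `t ≤ 1`).  NORMALISATION (★p1 g26 №13): `Ck_Q ∝ (cB∕c₀)·ℓ⁻⁶`, i.e. `a₀·ℓ⁻³`
at the pins `a = a₀(c₀∕cB)ℓ³` — the `ℓ⁻³` that O4e's `√(dℓ^d∕c₀)` eats; K-FREENESS of the (Q) decayed letter thus rests on (COL) exactly as the (P-Q†) sup row does.
[cite: Balaban1985BackgroundPropagators, (3.13)–(3.16) p.393, Thm 3.1 (3.42) p.397, (3.49) p.399; Balaban1984PropagatorsI, (1.18) p.20] -/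
theorem hkQ_of_col {ε₀ : ℝ} (hε₀ : 0 < ε₀) (hε12 : 10 ^ 12 * (F.L : ℝ) ^ 3 * ε₀ ≤ 1)
    (U₀ : GaugeField (F.P K) 0 (Matrix.specialUnitaryGroup (Fin 2) ℂ)) (hreg : RegPr F n K ε₀ U₀) {a : ℝ} (ha : 0 ≤ a) {μ' : ℝ} (hμ' : 0 ≤ μ')
    {CQ : ℝ} (hCQ : 0 ≤ CQ)
    (hcol : ∀ (b : PBond (F.P K) 0) (X : Matrix (Fin 2) (Fin 2) ℂ),
      ∑ c : PBond (F.P n) 0, ‖QTwS F n K h U₀ (Pi.single b X) c‖ ≤ CQ * ((F.L : ℝ) ^ (K - n))⁻¹ ^ 2 * ‖X‖) :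
    ∀ (b : PBond (F.P K) 0) (Z : Matrix (Fin 2) (Fin 2) ℂ) (bd : PBond (F.P K) 0),
      ‖(toL2 F K c₀).symm (LinearMap.adjoint (Qk F n K h c₀ cB U₀) (((a : ℝ) : ℂ) • Qk F n K h c₀ cB U₀ (toL2 F K c₀ (Pi.single b Z)))) bd‖
        ≤ (2 * a * CQ ^ 2 * (cB / c₀) * ((F.L : ℝ) ^ (K - n))⁻¹ ^ 6 * Real.exp μ')
          * Real.exp (-(μ' * (Site.tdist (P := F.P K) (iterBlockOf (K - n) b.src) (iterBlockOf (K - n) bd.src) : ℝ))) * ‖Z‖ := by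
  classical
  intro b Z bd
  have hc₀ : 0 < c₀ := Fact.out
  have hcB : 0 < cB := Fact.out
  have hL0 : (0 : ℝ) < F.L := by exact_mod_cast lt_trans zero_lt_one F.hL.2
  have hℓ : (0 : ℝ) < (F.L : ℝ) ^ (K - n) := pow_pos hL0 _
  have hη : 0 < eta F n K := eta_pos F n K
  have hηℓ : eta F n K = ((F.L : ℝ) ^ (K - n))⁻¹ := by
    show ((F.L : ℝ)⁻¹) ^ (K - n) = ((F.L : ℝ) ^ (K - n))⁻¹; rw [inv_pow]
  set t : ℝ := (Site.tdist (P := F.P K) (iterBlockOf (K - n) b.src) (iterBlockOf (K - n) bd.src) : ℝ) with ht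
  by_cases hfar : 1 < Site.tdist (P := F.P K) (iterBlockOf (K - n) b.src) (iterBlockOf (K - n) bd.src)
  · rw [symm_adjointQk_smul_Qk_single_eq_zero_of_far F h c₀ cB hε₀ hε12 U₀ hreg _ b Z bd hfar, norm_zero]
    positivity
  · rw [not_lt] at hfar
    have ht1 : t ≤ 1 := by rw [ht]; exact_mod_cast hfar
    -- `a • Q_k(toL2(δ_b ⊗ Z)) = toL2B Y`, `‖Y‖_∞ ≤ a·η·C_Q·ℓ⁻²·‖Z‖`
    set Y : PBond (F.P n) 0 → Matrix (Fin 2) (Fin 2) ℂ := fun c => (((a : ℝ) : ℂ) * ((eta F n K : ℝ) : ℂ)) • QTwS F n K h U₀ (Pi.single b Z) c with hY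
    have hQY : ((a : ℝ) : ℂ) • Qk F n K h c₀ cB U₀ (toL2 F K c₀ (Pi.single b Z)) = toL2B F n cB Y := by
      rw [Qk_toL2, smul_smul, ← map_smul]; rfl
    have hYsup : ‖Y‖ ≤ a * eta F n K * (CQ * ((F.L : ℝ) ^ (K - n))⁻¹ ^ 2 * ‖Z‖) := by
      refine (pi_norm_le_iff_of_nonneg (by positivity)).2 fun c => ?_
      simp only [hY]
      rw [norm_smul, norm_mul, Complex.norm_real, Complex.norm_real, Real.norm_of_nonneg ha, Real.norm_of_nonneg hη.le]
      refine mul_le_mul_of_nonneg_left ?_ (mul_nonneg ha hη.le)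
      exact (Finset.single_le_sum (f := fun c' => ‖QTwS F n K h U₀ (Pi.single b Z) c'‖) (fun _ _ => norm_nonneg _) (Finset.mem_univ c)).trans (hcol b Z)
    have hrow := norm_toL2_symm_adjoint_Qk_apply_le_of_col F h c₀ cB U₀ hCQ hcol Y bd
    rw [← hQY] at hrow
    have hK0 : 0 ≤ 2 * CQ * (cB / c₀) * ((F.L : ℝ) ^ (K - n))⁻¹ ^ 3 := by positivity
    have hexp : 1 ≤ Real.exp μ' * Real.exp (-(μ' * t)) := by
      rw [← Real.exp_add]; exact Real.one_le_exp (by nlinarith)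
    have hmain : ‖(toL2 F K c₀).symm (LinearMap.adjoint (Qk F n K h c₀ cB U₀) (((a : ℝ) : ℂ) • Qk F n K h c₀ cB U₀ (toL2 F K c₀ (Pi.single b Z)))) bd‖
        ≤ 2 * a * CQ ^ 2 * (cB / c₀) * ((F.L : ℝ) ^ (K - n))⁻¹ ^ 6 * ‖Z‖ := by
      calc _ ≤ 2 * CQ * (cB / c₀) * ((F.L : ℝ) ^ (K - n))⁻¹ ^ 3 * ‖Y‖ := hrow
        _ ≤ 2 * CQ * (cB / c₀) * ((F.L : ℝ) ^ (K - n))⁻¹ ^ 3 * (a * eta F n K * (CQ * ((F.L : ℝ) ^ (K - n))⁻¹ ^ 2 * ‖Z‖)) :=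
            mul_le_mul_of_nonneg_left hYsup hK0
        _ = 2 * a * CQ ^ 2 * (cB / c₀) * ((F.L : ℝ) ^ (K - n))⁻¹ ^ 6 * ‖Z‖ := by rw [hηℓ]; ring
    have hZ0 : 0 ≤ 2 * a * CQ ^ 2 * (cB / c₀) * ((F.L : ℝ) ^ (K - n))⁻¹ ^ 6 * ‖Z‖ := by positivity
    calc _ ≤ 2 * a * CQ ^ 2 * (cB / c₀) * ((F.L : ℝ) ^ (K - n))⁻¹ ^ 6 * ‖Z‖ := hmain
      _ ≤ 2 * a * CQ ^ 2 * (cB / c₀) * ((F.L : ℝ) ^ (K - n))⁻¹ ^ 6 * ‖Z‖ * (Real.exp μ' * Real.exp (-(μ' * t))) := le_mul_of_one_le_right hZ0 hexp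
      _ = (2 * a * CQ ^ 2 * (cB / c₀) * ((F.L : ℝ) ^ (K - n))⁻¹ ^ 6 * Real.exp μ') * Real.exp (-(μ' * t)) * ‖Z‖ := by ring

end Summit.QuantumFields.YangMills.Theorems.Prop7QkPenaltyKernelRow

end
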